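import Literature.InformationTheory.QuantumCodes.QuantumReedMullerCodesShortened
import Summits.Ventures.QEC.Decoders.HGPReedMullerFamily
import HarnessLib

/-!
# The hypergraph product of the SHORTENED Reed–Muller generator matrix with itself: the odd-distance sibling family
# `HGP(Ḡ_{b,m}, Ḡ_{b,m}) = [[(2^m − 1)² + (A − 1)², (2^m − A)², 2^{b+1} − 1]]`, `A = Σ_{i≤b} C(m,i)`, every `b < m`

LADDER-QEC (venture cell `qec`), PARTITION row 08 (qec-type-08 gen 6, «08.HGPRM*», sibling of `HGPReedMullerFamily.lean`
(«08.HGPRM») in the lineage of `HGPHammingFamily.lean`). The seed is the SHORTENED generator matrix `Ḡ_{b,m}` of `ℛ(b,m)`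
(`QRM.shortGenMatrix m b` of `QuantumReedMullerCodesShortened.lean`: rows = the monomials of degree `1 … b`, columns = the
`2^m − 1` nonzero points; full rank `A − 1`). As a parity-check matrix it defines the PUNCTURED Reed–Muller code
`ker Ḡ_{b,m} = ℛ(m−b−1, m)^* = [2^m − 1, 2^m − A, 2^{b+1} − 1]` (a word `v` lies in the kernel iff its even extension lies in
`ℛ(m−b−1,m)`, `shortGenMatrix_mulVec_eq_zero_iff`; MacWilliams–Sloane Ch. 13 §3 Thm 3 / §5); at `b = 1` this is the Hamming
check matrix `H_m` and its Hamming code, so the family below CONTAINS the HGP-Hamming family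
`[[(2^r−1)² + r², (2^r−1−r)², 3]]` of `HGPHammingFamily.lean` (members `[[58,16,3]]`, `[[241,121,3]]` re-derived here as a
consistency check). Tillich–Zémor's Theorem 1 (`HGP.isCode_of_le_transpose`) gives, for EVERY `b < m`,

  `HGP(Ḡ, Ḡ) = [[(2^m − 1)² + (A − 1)², (2^m − A)², 2^{b+1} − 1]]`.

* `prmRows m b = A − 1`, `card_monoPos'`, `prmGen m b : Matrix (Fin (prmRows m b)) (Fin (2^m − 1)) (ZMod 2)` (definitions);
* `rank_prmGen`, `minDist_pcCode_shortGenMatrix = 2^{b+1} − 1` (classical distance of the punctured Reed–Muller code),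
  `minDist_pcCode_prmGen`, `pcCode_prmGen_transpose = ⊥`;
* ★ `puncturedReedMuller_isCode (hb : b < m)`;
* members `hgpPRM_3_1 : [[58,16,3]]`, `hgpPRM_4_1 : [[241,121,3]]`, `hgpPRM_4_2 : [[325,25,7]]`, `hgpPRM_5_2 : [[1186,256,7]]`,
  `hgpPRM_5_3 : [[1586,36,15]]`, `hgpPRM_7_3 : [[20098,4096,15]]`;
* Q4: `puncturedReedMuller_hasOptimalRadius` — radius `2^b − 1` attained and optimal (`⌊(2^{b+1} − 2)/2⌋ = 2^b − 1`).

TIER: CERTIFIED (KERNEL-std); 0 named facts, 0 sorry, no `native_decide`; axioms ⊆ {propext, Classical.choice, Quot.sound}.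
HONEST FRAMING: an INSTANCE of Tillich–Zémor Thm 1 with a textbook classical seed; NOT LDPC; whether tabulated in print is not
asserted; code-capacity statements only; no novelty word.

References: [TillichZemor2014] Thm 1 (§6), Thm 7 / Thm 9 / Lemma 10 (arXiv v1 chunks p0007 L126-135, p0008 L11-15, L57-62);
[MacWilliamsSloane1977] Ch. 13 §3 Thm 3 (chunk p0308), §5 (punctured Reed–Muller codes); [Gottesman1997] §2.3.
-/

namespace Summit.Ventures.QEC.HGP

open Matrix Finset Literature.InformationTheory.QuantumCodes Literature.InformationTheory.QuantumCodes.QRM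
open Literature.InformationTheory.Coding

/-- Re-reading an `[[n,k,d]]` statement with equal parameters. [folklore] -/
private theorem isCode_congr' {RX RZ Q : Type*} [Fintype RX] [Fintype RZ] [Fintype Q] [DecidableEq Q]
    {C : CSSCode RX RZ Q} {n k d n' k' d' : ℕ} (h : C.IsCode n k d) (hn : n = n') (hk : k = k') (hd : d = d') :
    C.IsCode n' k' d' := by
  subst hn hk hd; exact h

variable {m : ℕ}

/-! ## The classical distance of the punctured Reed–Muller code `ker Ḡ_{b,m}` -/

/-- Weight of a word on `𝔽₂^m` = weight of its restriction to the nonzero points + its bit at `0`. [folklore] -/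
private theorem hammingNorm_restrict_add (g : (Fin m → ZMod 2) → ZMod 2) :
    hammingNorm g = hammingNorm (QRM.restrict g) + (if g 0 = 0 then 0 else 1) := by
  classical
  unfold hammingNorm QRM.restrict
  rw [card_filter, card_filter, ← Finset.add_sum_erase _ _ (mem_univ (0 : Fin m → ZMod 2)), add_comm]
  congr 1
  · exact Finset.sum_subtype (univ.erase 0) (fun x => by simp) (fun x => if g x ≠ 0 then 1 else 0)
  · by_cases h : g 0 = 0 <;> simp [h]

/-- Restricting the even extension gives the word back. [folklore] -/
private theorem restrict_evenExt (v : Pt m → ZMod 2) : QRM.restrict (evenExt v) = v := by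
  funext x
  simp [QRM.restrict, evenExt, extend, x.2]

/-- **`d(ker Ḡ_{b,m}) = 2^{b+1} − 1`** (`b < m`): the punctured Reed–Muller code `ℛ(m−b−1,m)^*`. Lower bound: the even extension
of a nonzero kernel word is a nonzero word of `ℛ(m−b−1,m)`, of weight `≥ 2^{b+1}`, and puncturing loses at most one unit of
weight; the witness is `QRM.exists_logical`. [cite: MacWilliamsSloane1977, Ch. 13 §3 Thm. 3 (chunk p0308) and §5 (punctured RM codes)] -/
theorem minDist_pcCode_shortGenMatrix {b : ℕ} (hb : b < m) :
    minDist (pcCode (shortGenMatrix m b)) = (2 ^ (b + 1) - 1 : ℕ) := by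
  obtain ⟨s, hs⟩ : ∃ s, b + s + 1 = m := ⟨m - b - 1, by omega⟩
  have hms : m - s = b + 1 := by omega
  refine le_antisymm ?_ (le_minDist_iff.2 fun c hc h0 => ?_)
  · obtain ⟨v, hv, -, hw⟩ := exists_logical (m := m) (r := b) (s := s) hs
    have h0 : v ≠ 0 := by
      intro h0
      rw [h0, hammingNorm_zero] at hw
      have := Nat.one_lt_two_pow (n := b + 1) (by omega)
      omega
    have := minDist_le_hammingNorm ((mem_pcCode_iff _ _).2 hv) h0
    rwa [hw] at this
  · have hg : evenExt c ∈ ReedMuller.code s m := (shortGenMatrix_mulVec_eq_zero_iff hs c).1 ((mem_pcCode_iff _ _).1 hc)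
    have hgne : evenExt c ≠ 0 := by
      intro h; apply h0
      rw [← restrict_evenExt c, h]; rfl
    have hwt := ReedMullerMinDistance.two_pow_le_hammingNorm m s _ hg hgne
    rw [hms, hammingNorm_restrict_add, restrict_evenExt] at hwt
    have : hammingNorm c + 1 ≥ 2 ^ (b + 1) := by split_ifs at hwt <;> omega
    exact_mod_cast (show 2 ^ (b + 1) - 1 ≤ hammingNorm c by omega)

/-! ## The flattened shortened generator matrix -/

/-- `|{S : 1 ≤ |S| ≤ b}| + 1 = A(m,b)` (the constant monomial removed). [folklore] -/
theorem card_monoPos' (m b : ℕ) : Fintype.card (MonoPos m b) + 1 = rmRows m b := by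
  have h := rank_shortGenMatrix m b
  rw [← finrank_rowSpace_eq_rank, rowSpace_eq_span_rows, finrank_span_eq_card (linearIndependent_shortGenMatrix m b)] at h
  rw [rmRows]; exact h

/-- `A(m,b) − 1` — the number of rows of `Ḡ_{b,m}`. (definition) [cite: MacWilliamsSloane1977, Ch. 13 §3 (chunk p0306)] -/
def prmRows (m b : ℕ) : ℕ := rmRows m b - 1

/-- **The shortened Reed–Muller generator matrix `Ḡ_{b,m}` as a `Fin`-indexed matrix.** (definition)
[cite: MacWilliamsSloane1977, Ch. 13 §5 (punctured Reed–Muller codes)] -/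
noncomputable def prmGen (m b : ℕ) : Matrix (Fin (prmRows m b)) (Fin (2 ^ m - 1)) (ZMod 2) :=
  (shortGenMatrix m b).submatrix
    (Fintype.equivFinOfCardEq (show Fintype.card (MonoPos m b) = prmRows m b by
      rw [prmRows, ← card_monoPos' m b, Nat.add_sub_cancel])).symm
    (Fintype.equivFinOfCardEq (card_pt m)).symm

/-- **`rank Ḡ_{b,m} = A − 1`**. [cite: LandahlCesare2013, §6 (chunk p0012 L69-73)] -/
theorem rank_prmGen (m b : ℕ) : (prmGen m b).rank = prmRows m b := by
  rw [prmGen, rank_submatrix, ← finrank_rowSpace_eq_rank, rowSpace_eq_span_rows,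
    finrank_span_eq_card (linearIndependent_shortGenMatrix m b), prmRows, ← card_monoPos' m b, Nat.add_sub_cancel]

/-- `d(ker Ḡ_{b,m}) = 2^{b+1} − 1` for the flattened matrix. [cite: MacWilliamsSloane1977, Ch. 13 §3 Thm. 3 (chunk p0308)] -/
theorem minDist_pcCode_prmGen {b : ℕ} (hb : b < m) : minDist (pcCode (prmGen m b)) = (2 ^ (b + 1) - 1 : ℕ) := by
  rw [← minDist_pcCode_shortGenMatrix hb, prmGen]
  set ρ := (Fintype.equivFinOfCardEq (show Fintype.card (MonoPos m b) = prmRows m b by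
      rw [prmRows, ← card_monoPos' m b, Nat.add_sub_cancel])).symm
  set σ := (Fintype.equivFinOfCardEq (card_pt m)).symm
  have h1 : (shortGenMatrix m b).submatrix ρ σ = (((shortGenMatrix m b).submatrix ρ id).submatrix id σ) := rfl
  have h2 : pcCode (((shortGenMatrix m b).submatrix ρ id).submatrix id σ) =
      reindex σ.symm (pcCode ((shortGenMatrix m b).submatrix ρ id)) := by
    ext e
    rw [mem_pcCode_submatrix_iff, mem_reindex_iff]
    rfl
  rw [h1, h2, minDist_reindex, pcCode_submatrix_equiv_rows]

/-- **`ker Ḡ_{b,m}ᵀ = 0`** (full row rank). [cite: TillichZemor2014, Thm 1 (§6: full-rank seed)] -/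
theorem pcCode_prmGen_transpose (m b : ℕ) : pcCode (prmGen m b)ᵀ = ⊥ :=
  pcCode_transpose_eq_bot_of_rank_eq _ (by rw [rank_prmGen, Fintype.card_fin])

/-! ## The family theorem -/

/-- ★ **`HGP(Ḡ_{b,m}, Ḡ_{b,m}) = [[(2^m − 1)² + (A − 1)², (2^m − A)², 2^{b+1} − 1]]` for every `b < m`** (Tillich–Zémor Thm 1 with the
full-rank seed `Ḡ_{b,m}`, `[n,k,d] = [2^m − 1, 2^m − A, 2^{b+1} − 1]`). [cite: TillichZemor2014, Thm 1 (§6) and Thm 7 / Thm 9 / Lemma 10 (arXiv v1 chunks p0007 L126-135, p0008 L11-15, L57-62)] [cite: MacWilliamsSloane1977, Ch. 13 §3 Thm. 3, §5] -/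
theorem puncturedReedMuller_isCode {b : ℕ} (hb : b < m) :
    (HGP.code (prmGen m b) (prmGen m b)).IsCode ((2 ^ m - 1) * (2 ^ m - 1) + prmRows m b * prmRows m b)
      ((2 ^ m - 1 - prmRows m b) * (2 ^ m - 1 - prmRows m b)) (2 ^ (b + 1) - 1) :=
  HGP.isCode_of_le_transpose (prmGen m b) (prmGen m b) (rank_prmGen m b) (rank_prmGen m b)
    (minDist_pcCode_prmGen hb) (minDist_pcCode_prmGen hb)
    (by rw [pcCode_prmGen_transpose, minDist_bot]; exact le_top) (by rw [pcCode_prmGen_transpose, minDist_bot]; exact le_top)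
    rfl (by rw [Nat.sub_self, zero_mul, add_zero]) (min_self _)

/-! ## Members -/

/-- `A(5,3) = 26`. [cite: MacWilliamsSloane1977, Ch. 13 §3 (chunk p0306)] -/
theorem rmRows_5_3 : rmRows 5 3 = 26 := by decide

/-- `(m,b) = (3,1)`: `[[58, 16, 3]]` — `Ḡ_{1,3} = H_3`, the same parameters as `HGPHammingFamily.hamming3_isCode` (consistency check).
[cite: TillichZemor2014, Thm 1 (§6)] -/
theorem hgpPRM_3_1 : (HGP.code (prmGen 3 1) (prmGen 3 1)).IsCode 58 16 3 :=
  isCode_congr' (puncturedReedMuller_isCode (m := 3) (b := 1) (by norm_num))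
    (by rw [prmRows, rmRows_3_1]; norm_num) (by rw [prmRows, rmRows_3_1]; norm_num) (by norm_num)

/-- `(m,b) = (4,1)`: `[[241, 121, 3]]` (`Ḡ_{1,4} = H_4`). [cite: TillichZemor2014, Thm 1 (§6)] -/
theorem hgpPRM_4_1 : (HGP.code (prmGen 4 1) (prmGen 4 1)).IsCode 241 121 3 :=
  isCode_congr' (puncturedReedMuller_isCode (m := 4) (b := 1) (by norm_num))
    (by rw [prmRows, rmRows_4_1]; norm_num) (by rw [prmRows, rmRows_4_1]; norm_num) (by norm_num)

/-- `(m,b) = (4,2)`: `[[325, 25, 7]]` (seed `ℛ(1,4)^* = [15,5,7]`). [cite: TillichZemor2014, Thm 1 (§6)] -/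
theorem hgpPRM_4_2 : (HGP.code (prmGen 4 2) (prmGen 4 2)).IsCode 325 25 7 :=
  isCode_congr' (puncturedReedMuller_isCode (m := 4) (b := 2) (by norm_num))
    (by rw [prmRows, rmRows_4_2]; norm_num) (by rw [prmRows, rmRows_4_2]; norm_num) (by norm_num)

/-- `(m,b) = (5,2)`: `[[1186, 256, 7]]` (seed `ℛ(2,5)^* = [31,16,7]`). [cite: TillichZemor2014, Thm 1 (§6)] -/
theorem hgpPRM_5_2 : (HGP.code (prmGen 5 2) (prmGen 5 2)).IsCode 1186 256 7 :=
  isCode_congr' (puncturedReedMuller_isCode (m := 5) (b := 2) (by norm_num))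
    (by rw [prmRows, rmRows_5_2]; norm_num) (by rw [prmRows, rmRows_5_2]; norm_num) (by norm_num)

/-- `(m,b) = (5,3)`: `[[1586, 36, 15]]` (seed `ℛ(1,5)^* = [31,6,15]`). [cite: TillichZemor2014, Thm 1 (§6)] -/
theorem hgpPRM_5_3 : (HGP.code (prmGen 5 3) (prmGen 5 3)).IsCode 1586 36 15 :=
  isCode_congr' (puncturedReedMuller_isCode (m := 5) (b := 3) (by norm_num))
    (by rw [prmRows, rmRows_5_3]; norm_num) (by rw [prmRows, rmRows_5_3]; norm_num) (by norm_num)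

/-- `(m,b) = (7,3)`: `[[20098, 4096, 15]]` (seed `ℛ(3,7)^* = [127,64,15]`). [cite: TillichZemor2014, Thm 1 (§6)] -/
theorem hgpPRM_7_3 : (HGP.code (prmGen 7 3) (prmGen 7 3)).IsCode 20098 4096 15 :=
  isCode_congr' (puncturedReedMuller_isCode (m := 7) (b := 3) (by norm_num))
    (by rw [prmRows, rmRows_7_3]; norm_num) (by rw [prmRows, rmRows_7_3]; norm_num) (by norm_num)

/-! ## Q4: correction radius -/

/-- `⌊(2^{b+1} − 1 − 1)/2⌋ = 2^b − 1`. [folklore] -/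
private theorem two_pow_succ_sub_two_div_two (b : ℕ) : (2 ^ (b + 1) - 1 - 1) / 2 = 2 ^ b - 1 := by
  have := Nat.one_le_two_pow (n := b)
  rw [pow_succ]; omega

/-- ★ **Q4 — the radius `2^b − 1` is attained and optimal** for every member (`b < m`).
[cite: TillichZemor2014, Thm 1 (§6)] [cite: Gottesman1997, §2.3 (chunk p0014 L3: distance 2t+1 corrects t errors)] -/
theorem puncturedReedMuller_hasOptimalRadius {b : ℕ} (hb : b < m) :
    (HGP.code (prmGen m b) (prmGen m b)).flatFin.HasOptimalRadius (2 ^ b - 1) :=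
  (puncturedReedMuller_isCode hb).flatFin_hasOptimalRadius (two_pow_succ_sub_two_div_two b)

/-! ## Appendix: mixed seeds — the full generator matrix `G_{b₁,m₁}` against the shortened one `Ḡ_{b₂,m₂}` -/

/-- ★ **`HGP(G_{b₁,m₁}, Ḡ_{b₂,m₂}) = [[2^{m₁}(2^{m₂} − 1) + A₁(A₂ − 1), (2^{m₁} − A₁)(2^{m₂} − A₂), min(2^{b₁+1}, 2^{b₂+1} − 1)]]`** for all
`b₁ < m₁`, `b₂ < m₂` (Tillich–Zémor Thm 7 form with one Reed–Muller and one punctured Reed–Muller seed).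
[cite: TillichZemor2014, Thm 7 / Thm 9 / Lemma 10 (arXiv v1 chunks p0007 L126-135, p0008 L11-15, L57-62)] [cite: MacWilliamsSloane1977, Ch. 13 §3 Thm. 3, §5] -/
theorem reedMuller_punctured_isCode {m₁ b₁ m₂ b₂ : ℕ} (hb₁ : b₁ < m₁) (hb₂ : b₂ < m₂) :
    (HGP.code (rmGen m₁ b₁) (prmGen m₂ b₂)).IsCode (2 ^ m₁ * (2 ^ m₂ - 1) + rmRows m₁ b₁ * prmRows m₂ b₂)
      ((2 ^ m₁ - rmRows m₁ b₁) * (2 ^ m₂ - 1 - prmRows m₂ b₂)) (min (2 ^ (b₁ + 1)) (2 ^ (b₂ + 1) - 1)) :=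
  HGP.isCode_of_le_transpose (rmGen m₁ b₁) (prmGen m₂ b₂) (rank_rmGen m₁ b₁) (rank_prmGen m₂ b₂)
    (minDist_pcCode_rmGen hb₁) (minDist_pcCode_prmGen hb₂)
    (by rw [pcCode_rmGen_transpose, minDist_bot]; exact le_top) (by rw [pcCode_prmGen_transpose, minDist_bot]; exact le_top)
    rfl (by rw [Nat.sub_self, zero_mul, add_zero]) rfl

/-- `HGP(G_{1,3}, Ḡ_{2,4}) = [[160, 20, 4]]` (seeds `ℛ(1,3) = [8,4,4]` and `ℛ(1,4)^* = [15,5,7]`). [cite: TillichZemor2014, Thm 7 (§4)] -/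
theorem hgpRMP_3_1_4_2 : (HGP.code (rmGen 3 1) (prmGen 4 2)).IsCode 160 20 4 :=
  isCode_congr' (reedMuller_punctured_isCode (m₁ := 3) (b₁ := 1) (m₂ := 4) (b₂ := 2) (by norm_num) (by norm_num))
    (by rw [prmRows, rmRows_3_1, rmRows_4_2]; norm_num) (by rw [prmRows, rmRows_3_1, rmRows_4_2]; norm_num) (by norm_num)

/-- `HGP(G_{2,5}, Ḡ_{2,5}) = [[1232, 256, 7]]` (seeds `ℛ(2,5) = [32,16,8]` and `ℛ(2,5)^* = [31,16,7]`). [cite: TillichZemor2014, Thm 7 (§4)] -/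
theorem hgpRMP_5_2_5_2 : (HGP.code (rmGen 5 2) (prmGen 5 2)).IsCode 1232 256 7 :=
  isCode_congr' (reedMuller_punctured_isCode (m₁ := 5) (b₁ := 2) (m₂ := 5) (b₂ := 2) (by norm_num) (by norm_num))
    (by rw [prmRows, rmRows_5_2]; norm_num) (by rw [prmRows, rmRows_5_2]; norm_num) (by norm_num)

/-! ## Appendix: two different shortened seeds `Ḡ_{b₁,m₁}`, `Ḡ_{b₂,m₂}` (e.g. two different Hamming matrices) -/

/-- ★ **`HGP(Ḡ_{b₁,m₁}, Ḡ_{b₂,m₂}) = [[(2^{m₁} − 1)(2^{m₂} − 1) + (A₁ − 1)(A₂ − 1), (2^{m₁} − A₁)(2^{m₂} − A₂), min(2^{b₁+1} − 1, 2^{b₂+1} − 1)]]`**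
for all `b₁ < m₁`, `b₂ < m₂`; at `b₁ = b₂ = 1` the hypergraph product of two DIFFERENT Hamming check matrices `H_{m₁}`, `H_{m₂}`.
[cite: TillichZemor2014, Thm 7 / Thm 9 / Lemma 10 (arXiv v1 chunks p0007 L126-135, p0008 L11-15, L57-62)] [cite: MacWilliamsSloane1977, Ch. 13 §3 Thm. 3, §5] -/
theorem puncturedReedMuller_isCode₂ {m₁ b₁ m₂ b₂ : ℕ} (hb₁ : b₁ < m₁) (hb₂ : b₂ < m₂) :
    (HGP.code (prmGen m₁ b₁) (prmGen m₂ b₂)).IsCode ((2 ^ m₁ - 1) * (2 ^ m₂ - 1) + prmRows m₁ b₁ * prmRows m₂ b₂)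
      ((2 ^ m₁ - 1 - prmRows m₁ b₁) * (2 ^ m₂ - 1 - prmRows m₂ b₂)) (min (2 ^ (b₁ + 1) - 1) (2 ^ (b₂ + 1) - 1)) :=
  HGP.isCode_of_le_transpose (prmGen m₁ b₁) (prmGen m₂ b₂) (rank_prmGen m₁ b₁) (rank_prmGen m₂ b₂)
    (minDist_pcCode_prmGen hb₁) (minDist_pcCode_prmGen hb₂)
    (by rw [pcCode_prmGen_transpose, minDist_bot]; exact le_top) (by rw [pcCode_prmGen_transpose, minDist_bot]; exact le_top)
    rfl (by rw [Nat.sub_self, zero_mul, add_zero]) rfl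

/-- `HGP(H_3, H_4) = HGP(Ḡ_{1,3}, Ḡ_{1,4}) = [[117, 44, 3]]` (two different Hamming seeds `[7,4,3]`, `[15,11,3]`). [cite: TillichZemor2014, Thm 7 (§4)] -/
theorem hgpPRM_3_1_4_1 : (HGP.code (prmGen 3 1) (prmGen 4 1)).IsCode 117 44 3 :=
  isCode_congr' (puncturedReedMuller_isCode₂ (m₁ := 3) (b₁ := 1) (m₂ := 4) (b₂ := 1) (by norm_num) (by norm_num))
    (by rw [prmRows, prmRows, rmRows_3_1, rmRows_4_1]; norm_num) (by rw [prmRows, prmRows, rmRows_3_1, rmRows_4_1]; norm_num) (by norm_num)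

/-- `HGP(Ḡ_{2,5}, Ḡ_{3,7}) = [[4882, 1024, 7]]` (seeds `[31,16,7]`, `[127,64,15]`). [cite: TillichZemor2014, Thm 7 (§4)] -/
theorem hgpPRM_5_2_7_3 : (HGP.code (prmGen 5 2) (prmGen 7 3)).IsCode 4882 1024 7 :=
  isCode_congr' (puncturedReedMuller_isCode₂ (m₁ := 5) (b₁ := 2) (m₂ := 7) (b₂ := 3) (by norm_num) (by norm_num))
    (by rw [prmRows, prmRows, rmRows_5_2, rmRows_7_3]; norm_num) (by rw [prmRows, prmRows, rmRows_5_2, rmRows_7_3]; norm_num) (by norm_num)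

end Summit.Ventures.QEC.HGP

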